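import Summits.ABC.IUTFork.Joshi.ATS1SelfSimilarity
import Summits.ABC.IUTFork.Joshi.ATS1Thm1111Proof
import HarnessLib

/-!
# Joshi, *Arithmetic Teichmüller Spaces I* (arXiv 2106.11452 v4) Thm. 11.1.1 — the claim-Prop `ATS1.Thm1111v2` DISCHARGED
# (proof-only; corollary of `ATS1Thm1111Proof.thm1111_main`)

Record file of the abc-iut cell, branch E (seat abc-iut-E-t25; rung LADDER-ABC:A2.E). TAKES NO SIDE on [IUTchIII] Cor. 3.12 or
on any author. `Joshi/ATS1SelfSimilarity.lean` (p430723/p432482) typed [J-I] Thm. 11.1.1 (p.53 l.64 – p.54 l.34) as the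
claim-Prop `Thm1111v2 p K vK`; `Joshi/ATS1Thm1111Proof.lean` (p433402) proved its body for every `p ≠ 0` (`thm1111_main`). Here the
named discharge `thm1111v2_holds` (every `p ≠ 0`, in particular every prime — Joshi's range; for `p = 0` the predicate is not his
sentence). (The deprecated v1 form `Thm1111` follows under its omitted standing hypothesis `CharZero K` by the same term; not restated.)
-/

namespace Summit.ABC.IUTFork.Joshi.ATS1

/-- **[J-I] Thm. 11.1.1 DISCHARGED**: the claim-Prop `Thm1111v2 p K vK` holds for every `p ≠ 0`, every field `K` and every real
absolute value `vK` (its hypotheses `CharZero K`, `IsAlgClosed K`, completeness, non-archimedean, `|p| < 1` are inside the Prop).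
[claim: Joshi2021ATS1, status: disputed] -/
theorem thm1111v2_holds {p : ℕ} (hp : p ≠ 0) (K : Type) [Field K] (vK : AbsoluteValue K ℝ) :
    Summit.ABC.IUTFork.Joshi.ATS1.Thm1111v2 p K vK :=
  SchmidtValuations.thm1111_main hp K vK

/-- … in particular for every prime `p` («Fix a prime number `p`», p.53 l.64). [claim: Joshi2021ATS1, status: disputed] -/
theorem thm1111v2_holds_of_prime (p : ℕ) [hp : Fact p.Prime] (K : Type) [Field K] (vK : AbsoluteValue K ℝ) :
    Summit.ABC.IUTFork.Joshi.ATS1.Thm1111v2 p K vK :=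
  thm1111v2_holds hp.1.ne_zero K vK

end Summit.ABC.IUTFork.Joshi.ATS1
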